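import Mathlib
import Summits.ValiantsHypothesis.ValiantsHypothesis.Theorems.LacunarySymmetroidMatrixDescartesCensusDefs
import Summits.ValiantsHypothesis.ValiantsHypothesis.Theorems.KPlusLogSqLawWeakLiftingTowerGraftCongruencePD

/-!
# Tower graft line, stub S4c: the corner reduction (rank-one far letter ↦ one diagonal corner, by congruence)

By-name closer for the registered stub S4c `stub_cornerReduction : TowerGraftLawCorner → TowerGraftLawRankOne` of the line
`Cruxes/WeakLifting/Lines/tower_graft.lean` (rev 5; crux `WeakLifting` = stmt-ValiantsHypothesis-19561, restricted sub-case
`TowerWeakLifting`; line planner val-idea-24 g0, critic val-idea-crit-6 g0, lead g27), with the line's `TowerGraftLawCorner`,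
`TowerGraftLawRankOne` and `IsTower` inlined:

`corner_reduction`: if grafting `X^D` onto ONE DIAGONAL ENTRY `(i,i)` of a symmetric tower pencil costs at most
`2^C·B + 2^{C·log₂²m}` positive roots (the corner graft law), then grafting a RANK-ONE far letter `X^D · v vᵀ` costs the same
(the rank-one graft law, same constant).  PROOF: `v = 0` is the bare pencil (budget `B`); for `v ≠ 0` pick `i` with `v i ≠ 0`,
let `U = 1.updateCol i v` (`det U = v i ≠ 0`, `U eᵢ = v`) and `V = U⁻¹`, so `V v = eᵢ` and `V (v vᵀ) Vᵀ = eᵢ eᵢᵀ`; congruence by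
`V` acts letterwise (`conj_graft_pencil`, lift-p3 g16's `…TowerGraftCongruencePD`), keeps the support, symmetry and — up to the
constant factor `(det V)²` — the determinant, hence the positive root set.

Def-free; the line discharges S4c by `exact corner_reduction`.  HONEST FRAMING: a congruence-normalisation joint between two
typed research rungs of a RESTRICTED sub-case; neither rung is proved here; nothing on `WeakLifting` itself, on Conjecture B /
`KPlusLogSqLaw`, on `MatrixDescartes` (18050) or on `VP ≠ VNP`.  Seat: prover val-sym-lift-p2 g17,
`--supports stmt-ValiantsHypothesis-19561`.
-/

-- `Summit.ValiantsHypothesis.ValiantsHypothesis.…` repeats a component by the D-0017 layout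
-- (single-conjunct summit), which the `dupNamespace` linter flags; the name is mandated.
set_option linter.dupNamespace false

namespace Summit.ValiantsHypothesis.ValiantsHypothesis.Theorems.KPlusLogSqLaw.TowerGraft

open Finset Polynomial Matrix
open scoped BigOperators Polynomial
open Summit.ValiantsHypothesis.ValiantsHypothesis.Theorems.LacunarySymmetroidMatrixDescartes (PosRootLawOn)

/-- A nonzero vector is congruent to a coordinate vector: for `v i ≠ 0` there is `V` with `det V ≠ 0` and `V v = eᵢ`
(`V = (1.updateCol i v)⁻¹`). [folklore] -/
theorem exists_mulVec_eq_single {m : ℕ} (v : Fin m → ℝ) (i : Fin m) (hi : v i ≠ 0) :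
    ∃ V : Matrix (Fin m) (Fin m) ℝ, V.det ≠ 0 ∧ V *ᵥ v = Pi.single i 1 := by
  classical
  set U : Matrix (Fin m) (Fin m) ℝ := (1 : Matrix (Fin m) (Fin m) ℝ).updateCol i v with hU
  have hdetU : U.det = v i := by
    rw [hU, ← Matrix.cramer_apply, Matrix.cramer_one]
    rfl
  have hUunit : IsUnit U.det := by rw [hdetU]; exact isUnit_iff_ne_zero.mpr hi
  have hUe : U *ᵥ Pi.single i 1 = v := by
    rw [Matrix.mulVec_single_one]
    funext j
    simp [hU, Matrix.col_apply, Matrix.updateCol_self]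
  refine ⟨U⁻¹, ?_, ?_⟩
  · intro h0
    have h1 := Matrix.det_nonsing_inv_mul_det U hUunit
    rw [h0, zero_mul] at h1
    exact zero_ne_one h1
  · rw [← hUe, Matrix.mulVec_mulVec, Matrix.nonsing_inv_mul U hUunit, Matrix.one_mulVec]

/-- **Support-level congruence reduction (rank-one far letter ↦ corner).**  For `v i ≠ 0` there are SYMMETRIC letters
`S'ₗ = V Sₗ Vᵀ` on the SAME support such that `det (∑ₗ X^{dₗ} Sₗ + X^D v vᵀ)` and `det (∑ₗ X^{dₗ} S'ₗ + X^D eᵢ eᵢᵀ)` have the same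
roots (they differ by the constant factor `(det V)² ≠ 0`). [this work] -/
theorem rankOne_graft_congruence {m K : ℕ} (d : Fin K → ℕ) (D : ℕ) (S : Fin K → Matrix (Fin m) (Fin m) ℝ)
    (hS : ∀ l, (S l).IsSymm) (v : Fin m → ℝ) (i : Fin m) (hi : v i ≠ 0) :
    ∃ S' : Fin K → Matrix (Fin m) (Fin m) ℝ, (∀ l, (S' l).IsSymm) ∧
      (Matrix.det ((∑ l, ((X : ℝ[X]) ^ d l) • (S l).map Polynomial.C) +
          (X : ℝ[X]) ^ D • (Matrix.vecMulVec v v).map Polynomial.C)).roots =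
      (Matrix.det ((∑ l, ((X : ℝ[X]) ^ d l) • (S' l).map Polynomial.C) +
          (X : ℝ[X]) ^ D • (Matrix.vecMulVec (Pi.single i (1 : ℝ)) (Pi.single i (1 : ℝ))).map Polynomial.C)).roots := by
  obtain ⟨V, hV, hVv⟩ := exists_mulVec_eq_single v i hi
  refine ⟨fun l => V * S l * Vᵀ, fun l => ?_, ?_⟩
  · show (V * S l * Vᵀ)ᵀ = V * S l * Vᵀ
    rw [Matrix.transpose_mul, Matrix.transpose_mul, Matrix.transpose_transpose, (hS l).eq, Matrix.mul_assoc]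
  · have hconj : V * Matrix.vecMulVec v v * Vᵀ = Matrix.vecMulVec (Pi.single i (1 : ℝ)) (Pi.single i (1 : ℝ)) := by
      rw [Matrix.mul_vecMulVec, Matrix.vecMulVec_mul, Matrix.vecMul_transpose, hVv]
    have h := congrArg Matrix.det (conj_graft_pencil V d D S (Matrix.vecMulVec v v))
    rw [hconj, Matrix.det_mul, Matrix.det_mul, Matrix.det_transpose] at h
    have hdet : (V.map Polynomial.C).det = Polynomial.C V.det := by
      rw [RingHom.map_det, RingHom.mapMatrix_apply]
    rw [hdet] at h
    rw [← h, mul_comm (Polynomial.C V.det) _, mul_assoc, ← Polynomial.C_mul, mul_comm,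
      Polynomial.roots_C_mul _ (mul_ne_zero hV hV)]

/-- **S4c `stub_cornerReduction` (verbatim, line defs inlined): the corner graft law implies the rank-one graft law, same
constant.**  `v = 0`: the graft is the bare pencil (budget `B ≤ 2^C·B + 2^{C·log₂²m}`); `v ≠ 0`: congruence to the corner
(`rankOne_graft_congruence`) and the corner law at the congruent letters. [this work] -/
theorem corner_reduction :
    (∃ C : ℕ, ∀ (m K B D : ℕ) (d : Fin K → ℕ), (∀ l l' : Fin K, l < l' → m * d l < d l') → (∀ l, m * d l < D) →
      PosRootLawOn m K B d → ∀ (S : Fin K → Matrix (Fin m) (Fin m) ℝ) (i : Fin m), (∀ l, (S l).IsSymm) →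
        ((Matrix.det ((∑ l, ((X : ℝ[X]) ^ d l) • (S l).map Polynomial.C) +
            (X : ℝ[X]) ^ D • (Matrix.vecMulVec (Pi.single i (1 : ℝ)) (Pi.single i (1 : ℝ))).map Polynomial.C)).roots.toFinset.filter
          (fun t => 0 < t)).card ≤ 2 ^ C * B + 2 ^ (C * Nat.log 2 m ^ 2)) →
    (∃ C : ℕ, ∀ (m K B D : ℕ) (d : Fin K → ℕ), (∀ l l' : Fin K, l < l' → m * d l < d l') → (∀ l, m * d l < D) →
      PosRootLawOn m K B d → ∀ (S : Fin K → Matrix (Fin m) (Fin m) ℝ) (v : Fin m → ℝ), (∀ l, (S l).IsSymm) →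
        ((Matrix.det ((∑ l, ((X : ℝ[X]) ^ d l) • (S l).map Polynomial.C) +
            (X : ℝ[X]) ^ D • (Matrix.vecMulVec v v).map Polynomial.C)).roots.toFinset.filter
          (fun t => 0 < t)).card ≤ 2 ^ C * B + 2 ^ (C * Nat.log 2 m ^ 2)) := by
  rintro ⟨C, hC⟩
  refine ⟨C, fun m K B D d hd hD hB S v hS => ?_⟩
  by_cases hv : v = 0
  · -- bare pencil: the rank-one letter vanishes
    subst hv
    have h0 : (X : ℝ[X]) ^ D • (Matrix.vecMulVec (0 : Fin m → ℝ) (0 : Fin m → ℝ)).map Polynomial.C =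
        (0 : Matrix (Fin m) (Fin m) ℝ[X]) := by
      rw [Matrix.zero_vecMulVec, Matrix.map_zero _ (map_zero _), smul_zero]
    rw [h0, add_zero]
    calc ((Matrix.det (∑ l, ((X : ℝ[X]) ^ d l) • (S l).map Polynomial.C)).roots.toFinset.filter
            (fun t => 0 < t)).card ≤ B := hB S hS
      _ ≤ 2 ^ C * B := Nat.le_mul_of_pos_left B (Nat.two_pow_pos C)
      _ ≤ 2 ^ C * B + 2 ^ (C * Nat.log 2 m ^ 2) := Nat.le_add_right _ _
  · obtain ⟨i, hi⟩ : ∃ i, v i ≠ 0 := Function.ne_iff.mp hv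
    obtain ⟨S', hS', hroots⟩ := rankOne_graft_congruence d D S hS v i hi
    rw [hroots]
    exact hC m K B D d hd hD hB S' i hS'

end Summit.ValiantsHypothesis.ValiantsHypothesis.Theorems.KPlusLogSqLaw.TowerGraft
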